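import Summits.NavierStokesRegularity.NavierStokesRegularity.Theses.ClockStretchingLaw
import Summits.NavierStokesRegularity.NavierStokesRegularity.Theorems.ClockStretchingLawClockCeilingLiouvilleNode
import Summits.NavierStokesRegularity.NavierStokesRegularity.Theorems.ClockStretchingLawClockCeilingStubFrameRigidity
import HarnessLib

/-!
# Skeleton (line `registered`, FINAL SHAPE by lead c2) — crux `ClockStretchingLaw.ClockCeiling`
# (stmt-NavierStokesRegularity-10570)

Route `route-NavierStokesRegularity-ClockStretchingLaw`, crux #2 `ClockCeiling`: along every element `u` of the
route's Type-I class `𝒦_C` (jointly smooth on `(-∞,0) × ℝ³`, divergence-free, KNSS-mild Oseen identity between all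
pairs of negative times, `‖u(t,x)‖ ≤ C/√(-t)`, scale-invariant local energies `A, E ≤ C`) the clock amplitude
`a_u(t) = (-t)^{3/2} ∫ ‖∂ₜu(t,x)‖² e^{-‖x‖²/(4(-t))} dx` is not bounded below on `[-1,0)`.

## History of the line

* birth (planner-skel): four-frame dichotomy `ClockCeiling ⇐ stub_frameRigidity ∧ stub_frameCeiling`.
* lead c1: `stub_frameRigidity` reshaped into five analytic stubs + composition, ALL LANDED
  (`Theorems.stub_frameRigidity`, p149959; stubs p147526 p149062 p149513 p147414 p148616); residual
  `stub_frameCeiling` = the crux's open content; outcome `promote-stub`.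
* lead c2 (this shape): the residual is TYPED. Landed `--supports` certificates:
  - `ClockStretchingLawClockCeilingIffTarget.lean` (p152790): `clockCeiling_of_regularOrigin` (at a bounded
    origin the ceiling is automatic, per element: the zoom limit at a bounded origin is the zero field),
    `stub_clockCeilingIffTarget : ClockCeiling ↔ NoSingularTypeIModel` (crux ≡ route target 10569, given the
    proved `ClockLaw`), `frameCeiling_iff_clockCeiling` (c1's residual stub ≡ crux);
  - `ClockStretchingLawClockCeilingLiouvilleNode.lean` (p153069): `stub_clockCeilingIffTypeIAncientLiouville :
    ClockCeiling ↔ SymmetryModuliCount.TypeIAncientLiouville` (stmt-4050) and `↔` SqueezeLiouville (11608),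
    ExtremalBiaxialitySubcritical (11609), RecurrentLiouville (1589), NoTypeIRateProfile (1588),
    NoApexTypeIProfile ∧ ApexLocalisation (11716 ∧ 11719); `¬ClockCeiling ↔ TypeISingularProfileExists`;
    `ClockCeiling ⇐ LiouvilleConjectureNS` (conditional);
  - `ClockStretchingLawClockCeilingUniformClockLaw.lean` (p153352): portrait of any counterexample —
    `stub_uniformClockLaw`: `∀ C ∃ δ(C) > 0`, every singular element of `𝒦_C` has `a_u(t) ≥ δ(C)` for ALL `t < 0`.

## FINAL SHAPE

The one remaining stub is, VERBATIM, the statement of item stmt-NavierStokesRegularity-4050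
(`SymmetryModuliCount.TypeIAncientLiouville`, Type-I Liouville in the KNSS gauge — the common target of routes
SymmetryModuliCount / ExtremalTypeIConstant and, by the landed node equivalences, of SqueezeCycle, RecurrentProfiles,
DulacContraction, RellichScar and of this route's own target `NoSingularTypeIModel`). `ClockCeiling_of` is the landed
equivalence `clockCeiling_iff_typeIAncientLiouville` applied to it. There is no line-internal content left: the crux
closes exactly when item 4050 closes (and conversely closes it).
-/

set_option linter.dupNamespace false

noncomputable section

namespace Summit.NavierStokesRegularity.NavierStokesRegularity.Cruxes.ClockCeiling.Registered

open scoped BigOperators Topology InnerProductSpace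
open MeasureTheory
open Summit.NavierStokesRegularity.NavierStokesRegularity.Theses.ClockStretchingLaw

/-! ## The residual stub = item stmt-NavierStokesRegularity-4050 verbatim -/

/-- **Stub `stub_typeIAncientLiouville` — THE RESIDUAL OF THE LINE = item stmt-NavierStokesRegularity-4050
(`SymmetryModuliCount.TypeIAncientLiouville`) letter for letter**: every smooth divergence-free KNSS-mild ancient
field on `ℝ³ × (−∞,0)` with `‖u(t,x)‖ ≤ C/√(−t)` vanishes. OPEN (Koch–Nadirashvili–Seregin–Šverák 2009; its negation
contains Bradshaw–Tsai 2017 Open Problem 5.1). By the landed certificates it is EQUIVALENT to the crux.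
[KNSS2009, AlbrittonBarker2019, BradshawTsai2017CPDE] -/
theorem stub_typeIAncientLiouville :
    ∀ (C : ℝ) (u : ℝ → EuclideanSpace ℝ (Fin 3) → EuclideanSpace ℝ (Fin 3)), ContDiffOn ℝ (⊤ : ℕ∞) (Function.uncurry u) (Set.Iio 0 ×ˢ Set.univ) ∧ (∀ t < 0, Literature.Analysis.FluidPDE.VectorCalculus.IsDivFree (u t)) ∧ (∀ s t : ℝ, s < t → t < 0 → ∀ x, u t x = Literature.Analysis.FluidPDE.heatFlow (u s) (t - s) x - ∫ τ in Set.Ioo s t, ∫ y, Literature.Analysis.FluidPDE.oseenKernel (t - τ) (x - y) (u τ y) (u τ y)) ∧ Literature.Analysis.FluidPDE.HasTypeITimeDecay C u → ∀ t < 0, ∀ x, u t x = 0 := by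
  sorry

/-! ## The skeleton theorem -/

/-- **`ClockCeiling` — the route declaration BY NAME** (item stmt-NavierStokesRegularity-10570), from the residual
stub through the landed equivalence `clockCeiling_iff_typeIAncientLiouville` (p153069). -/
theorem ClockCeiling_of : ClockCeiling :=
  Summit.NavierStokesRegularity.NavierStokesRegularity.Theorems.clockCeiling_iff_typeIAncientLiouville.2
    stub_typeIAncientLiouville

/-! ## Recorded equivalences (all landed; for the reader of this skeleton) -/

/-- The residual stub's statement is the crux: `TypeIAncientLiouville ↔ ClockCeiling` (p153069). [folklore] -/
theorem residual_iff_crux :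
    Summit.NavierStokesRegularity.NavierStokesRegularity.Theses.SymmetryModuliCount.TypeIAncientLiouville ↔ ClockCeiling :=
  Summit.NavierStokesRegularity.NavierStokesRegularity.Theorems.clockCeiling_iff_typeIAncientLiouville.symm

/-- The crux is the route target: `ClockCeiling ↔ NoSingularTypeIModel` (p152790). [folklore] -/
theorem crux_iff_target : ClockCeiling ↔ NoSingularTypeIModel :=
  Summit.NavierStokesRegularity.NavierStokesRegularity.Theorems.clockCeiling_iff_noSingularTypeIModel

/-- c1's residual stub `stub_frameCeiling` (four-frame ceiling) is the crux as well (p152790). [folklore] -/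
theorem frameCeiling_iff_crux :
    (∀ (C : ℝ) (u : ℝ → EuclideanSpace ℝ (Fin 3) → EuclideanSpace ℝ (Fin 3)), ContDiffOn ℝ (⊤ : ℕ∞) (Function.uncurry u) (Set.Iio 0 ×ˢ Set.univ) ∧ (∀ t < 0, Literature.Analysis.FluidPDE.VectorCalculus.IsDivFree (u t)) ∧ (∀ s t : ℝ, s < t → t < 0 → ∀ x, u t x = Literature.Analysis.FluidPDE.heatFlow (u s) (t - s) x - ∫ τ in Set.Ioo s t, ∫ y, ((-(inner ℝ (x - y) (u τ y) / (2 * (t - τ)) * Literature.Analysis.UnboundedOperators.heatKernel (t - τ) (x - y))) • u τ y + (∫ σ in Set.Ioi (t - τ), Literature.Analysis.UnboundedOperators.heatKernel σ (x - y) / (4 * σ ^ 2)) • (inner ℝ (x - y) (u τ y) • u τ y + inner ℝ (u τ y) (u τ y) • (x - y) + inner ℝ (x - y) (u τ y) • u τ y) - ((∫ σ in Set.Ioi (t - τ), Literature.Analysis.UnboundedOperators.heatKernel σ (x - y) / (8 * σ ^ 3)) * (inner ℝ (x - y) (u τ y) * inner ℝ (x - y) (u τ y))) • (x - y))) ∧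 Literature.Analysis.FluidPDE.HasTypeITimeDecay C u ∧ (∀ (x₀ : EuclideanSpace ℝ (Fin 3)) (t₀ r : ℝ), t₀ ≤ 0 → 0 < r → (∀ t, t₀ - r ^ 2 < t → t < t₀ → r⁻¹ * ∫ x in Metric.ball x₀ r, ‖u t x‖ ^ 2 ≤ C) ∧ r⁻¹ * ∫ t in Set.Ioo (t₀ - r ^ 2) t₀, ∫ x in Metric.ball x₀ r, ‖fderiv ℝ (u t) x‖ ^ 2 ≤ C) → ∀ η > 0, ∃ t : ℝ, -1 ≤ t ∧ t < 0 ∧ ∃ (c₀ : ℝ) (b : EuclideanSpace ℝ (Fin 3)), c₀ ^ 2 + ‖b‖ ^ 2 = 1 ∧ Real.sqrt (-t) * ∫ x, ‖(c₀ * Real.sqrt (-t)) • Literature.Analysis.FluidPDE.timeDeriv u t x + fderiv ℝ (u t) x b‖ ^ 2 * Real.exp (-(‖x‖ ^ 2) / (4 * (-t))) < η) ↔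
      ClockCeiling :=
  Summit.NavierStokesRegularity.NavierStokesRegularity.Theorems.frameCeiling_iff_clockCeiling

end Summit.NavierStokesRegularity.NavierStokesRegularity.Cruxes.ClockCeiling.Registered
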